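import Mathlib.Combinatorics.SetFamily.HarrisKleitman
import Mathlib.Combinatorics.Hall.Basic
import Literature.Probability.LatticeModels.ProdBernoulliCoupling
import Literature.Probability.LatticeModels.ProdBernoulliIndependence
import Literature.Probability.Percolation.FoldingFibres
import HarnessLib

/-!
# QUANT lane R8, FAR caricature I: the Harris–Kleitman / Hall transport and the high-gate small-ball bound

builds on p205010 (kernel theorem, internal audit signed; external expert review pending)

Support file (`--supports stmt-CriticalPhenomena-4575`), QUANT lane seat prim-quant-p2 (gen 20), rung R8 of
`run/shared/lean/prim/quant/LADDER.md`, for the R8 target of record `Quant.FarRelayRow` (lead g4, p214662,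
`PercNearOneGluingNoHeavyQuantFarRelayRow.lean`; memo `prim-quant-lead-g4/LEAD-NOTES-G4.md` N11 (5), (9)).
Theorems only; no definitions, no sorries, standard axioms.  Part II (`…QuantHalfMeanSmallBall.lean`) adds the
Cantelli regime and the caricature itself.

In the FIBRE / BLOCK-STAR picture of FAR (N11 (5)) the observer's relay count is `X = Σ_i a_i ε_i` with
INDEPENDENT gates `ε_i ~ Bern(p_i)` and integer blob sizes `a_i`.  Here: the product Bernoulli measure
`prodBernoulli p` on `Set ι` (`ι` finite), the mass `X(s) = Σ_{i ∈ s} a i`, and the HIGH-GATE statement, which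
needs no mean hypothesis at all:

* `Quant.halfMean_smallBall_of_card` — if every gate is at least `1 − t ≥ 1/2` and the total blob mass is
  `Σ_i a_i ≥ 2j + 1`, then `P(X ≤ j) ≤ t`.  Proof = monotone coupling down to the constant gate `g = 1 − t`
  (`prodBernoulli_real_mono_of_isUpperSet`) + a TRANSPORT on the cube: the light family
  `L = {S : a(S) ≤ j}` is a down-set with `|L| ≤ 2^{k-1}` (complementation maps `L` into `Lᶜ` since
  `a(S) + a(Sᶜ) ≥ 2j+1`), so by Harris–Kleitman (`IsUpperSet.card_inter_le_finset`) `L` fills at most half of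
  every up-set, which is Hall's condition (`Finset.all_card_le_biUnion_card_iff_exists_injective`) for an
  injection `φ : L → Lᶜ` with `φ S ⊋ S` (`Quant.exists_expanding_injection`); for `g ≥ 1/2` each step multiplies
  the weight by `(g/(1−g))^{|φS∖S|} ≥ g/(1−g)`, whence `g·μ_g(L) ≤ (1−g)·μ_g(Lᶜ)`, i.e. `μ_g(L) ≤ 1 − g`
  (`Quant.lightFamily_transport`, `Quant.halfMean_smallBall_const`).
  Sharp: equality for `a ≡ 1` on `2j+1` points at `g = 1/2`; `2j+1` cannot be `2j` (two unit blobs, `j = 1`: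
  `P(X ≤ 1) = 1 − g² > 1 − g`).

Nearest prior art searched (corpus hybrid + vsearch + galaxy, 2026-08-20): small-ball / anti-concentration bounds
for weighted Bernoulli sums at HALF the mean with the `max_i(1-p_i)` constant — none found; Kozma–Nitzan 2024
Lemma 2 is the level-1 graph statement of the FAR family. [cite: KozmaNitzan2024, Lemma 2 (p. 6), Conjecture 3 (p. 15)]
-/

noncomputable section

namespace Summit.CriticalPhenomena.PercolationContinuityZ3.Theorems

open MeasureTheory Set Finset
open Literature.Probability.LatticeModels
open Literature.Probability.Percolation (prodBernoulli_real_eq_sum_weight_ind)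
open Literature.Probability.Percolation.BHK2006 (weight weight_nonneg)
open Literature.Probability.Percolation.DecisionTree (ind ind_of_mem ind_of_not_mem ind_nonneg)
open scoped Classical

namespace Quant

variable {ι : Type*} [Fintype ι]

/-! ### 1. Combinatorics of the light family `L = {S | Σ_{i∈S} a i ≤ j}` -/

/-- The light family `{S | Σ_{i ∈ S} a i ≤ j}` is a down-set of the cube. [folklore] -/
theorem lightFamily_isLowerSet (a : ι → ℕ) (j : ℕ) :
    IsLowerSet ((univ.filter fun S : Finset ι => ∑ i ∈ S, a i ≤ j : Finset (Finset ι)) :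
      Set (Finset ι)) := by
  intro S T hTS hS
  rw [Finset.mem_coe, Finset.mem_filter] at hS ⊢
  exact ⟨Finset.mem_univ _, (Finset.sum_le_sum_of_subset hTS).trans hS.2⟩

/-- If the total mass is at least `2j+1`, complementation maps the light family into its complement, so the
light family has at most `2^{k-1}` members. [folklore] -/
theorem two_mul_card_lightFamily_le (a : ι → ℕ) (j : ℕ) (hT : 2 * j + 1 ≤ ∑ i, a i) :
    2 * (univ.filter fun S : Finset ι => ∑ i ∈ S, a i ≤ j).card ≤ 2 ^ Fintype.card ι := by
  set L : Finset (Finset ι) := univ.filter fun S : Finset ι => ∑ i ∈ S, a i ≤ j with hL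
  set L' : Finset (Finset ι) := L.map ⟨fun S => Sᶜ, compl_injective⟩ with hL'
  have hdisj : Disjoint L L' := by
    rw [Finset.disjoint_left]
    intro S hS hS'
    rw [hL', Finset.mem_map] at hS'
    obtain ⟨T, hT', hTS⟩ := hS'
    have h1 : ∑ i ∈ S, a i ≤ j := (Finset.mem_filter.1 hS).2
    have h2 : ∑ i ∈ T, a i ≤ j := (Finset.mem_filter.1 hT').2
    have h3 : ∑ i ∈ Tᶜ, a i + ∑ i ∈ T, a i = ∑ i, a i := Finset.sum_compl_add_sum T a
    have h4 : (Tᶜ : Finset ι) = S := hTS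
    rw [h4] at h3
    omega
  have hcard : (L ∪ L').card ≤ 2 ^ Fintype.card ι := by
    calc (L ∪ L').card ≤ (univ : Finset (Finset ι)).card := Finset.card_le_card (Finset.subset_univ _)
      _ = 2 ^ Fintype.card ι := by rw [Finset.card_univ, Fintype.card_finset]
  rw [Finset.card_union_of_disjoint hdisj, hL', Finset.card_map] at hcard
  omega

/-- Harris–Kleitman consequence: under total mass `≥ 2j+1` the light family fills at most half of every
up-set of the cube. [folklore; Mathlib `IsUpperSet.card_inter_le_finset`] -/
theorem card_inter_lightFamily_le (a : ι → ℕ) (j : ℕ) (hT : 2 * j + 1 ≤ ∑ i, a i)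
    (U : Finset (Finset ι)) (hU : IsUpperSet (U : Set (Finset ι))) :
    2 * (U ∩ univ.filter fun S : Finset ι => ∑ i ∈ S, a i ≤ j).card ≤ U.card := by
  set L : Finset (Finset ι) := univ.filter fun S : Finset ι => ∑ i ∈ S, a i ≤ j with hL
  have hK : 2 ^ Fintype.card ι * (U ∩ L).card ≤ U.card * L.card :=
    hU.card_inter_le_finset (lightFamily_isLowerSet a j)
  have h2 : 2 * L.card ≤ 2 ^ Fintype.card ι := two_mul_card_lightFamily_le a j hT
  have hpos : 0 < 2 ^ Fintype.card ι := by positivity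
  -- `2^k · 2 · |U ∩ L| ≤ 2 · |U| · |L| ≤ |U| · 2^k`
  have h3 : 2 ^ Fintype.card ι * (2 * (U ∩ L).card) ≤ 2 ^ Fintype.card ι * U.card := by
    calc 2 ^ Fintype.card ι * (2 * (U ∩ L).card) = 2 * (2 ^ Fintype.card ι * (U ∩ L).card) := by ring
      _ ≤ 2 * (U.card * L.card) := Nat.mul_le_mul_left 2 hK
      _ = U.card * (2 * L.card) := by ring
      _ ≤ U.card * 2 ^ Fintype.card ι := Nat.mul_le_mul_left _ h2
      _ = 2 ^ Fintype.card ι * U.card := by ring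
  exact Nat.le_of_mul_le_mul_left h3 hpos

/-- **The expanding injection.** Under total mass `≥ 2j+1` there is an injection `φ` from the light family into
the heavy family with `S ⊆ φ S` (hence `S ⊊ φ S`) — Hall's theorem, the condition being the half-filling of up-sets.
[folklore; Mathlib `Finset.all_card_le_biUnion_card_iff_exists_injective`] -/
theorem exists_expanding_injection (a : ι → ℕ) (j : ℕ) (hT : 2 * j + 1 ≤ ∑ i, a i) :
    ∃ φ : (univ.filter fun S : Finset ι => ∑ i ∈ S, a i ≤ j) → Finset ι,
      Function.Injective φ ∧
        ∀ S : (univ.filter fun S : Finset ι => ∑ i ∈ S, a i ≤ j),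
          (S : Finset ι) ⊆ φ S ∧ ¬ ∑ i ∈ φ S, a i ≤ j := by
  set L : Finset (Finset ι) := univ.filter fun S : Finset ι => ∑ i ∈ S, a i ≤ j with hL
  -- admissible targets of a light set: its heavy supersets
  set t : L → Finset (Finset ι) := fun S => univ.filter fun T : Finset ι =>
    (S : Finset ι) ⊆ T ∧ ¬ ∑ i ∈ T, a i ≤ j with ht
  have hall : ∀ 𝒮 : Finset L, 𝒮.card ≤ (𝒮.biUnion t).card := by
    intro 𝒮
    -- the up-closure of `𝒮`
    set U : Finset (Finset ι) := univ.filter fun T : Finset ι => ∃ S ∈ 𝒮, (S : Finset ι) ⊆ T with hUdef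
    have hU : IsUpperSet (U : Set (Finset ι)) := by
      intro T T' hTT' hT
      rw [Finset.mem_coe, hUdef, Finset.mem_filter] at hT ⊢
      obtain ⟨-, S, hS, hST⟩ := hT
      exact ⟨Finset.mem_univ _, S, hS, hST.trans hTT'⟩
    have hhalf : 2 * (U ∩ L).card ≤ U.card := card_inter_lightFamily_le a j hT U hU
    -- `𝒮` (as light sets) sits inside `U ∩ L`
    have h1 : 𝒮.card ≤ (U ∩ L).card := by
      rw [← Finset.card_map ⟨((↑) : L → Finset ι), Subtype.coe_injective⟩]
      refine Finset.card_le_card fun T hT => ?_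
      rw [Finset.mem_map] at hT
      obtain ⟨S, hS, rfl⟩ := hT
      refine Finset.mem_inter.2 ⟨?_, S.2⟩
      rw [hUdef, Finset.mem_filter]
      exact ⟨Finset.mem_univ _, S, hS, subset_rfl⟩
    -- the heavy part of `U` sits inside the admissible targets
    have h2 : (U \ L).card ≤ (𝒮.biUnion t).card := by
      refine Finset.card_le_card fun T hT => ?_
      rw [Finset.mem_sdiff] at hT
      obtain ⟨hTU, hTL⟩ := hT
      rw [hUdef, Finset.mem_filter] at hTU
      obtain ⟨-, S, hS, hST⟩ := hTU
      rw [Finset.mem_biUnion]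
      refine ⟨S, hS, ?_⟩
      rw [ht, Finset.mem_filter]
      refine ⟨Finset.mem_univ _, hST, fun hsum => hTL ?_⟩
      rw [hL, Finset.mem_filter]
      exact ⟨Finset.mem_univ _, hsum⟩
    -- `|U| = |U ∩ L| + |U \ L|` and `2 |U ∩ L| ≤ |U|`
    have h3 : (U ∩ L).card + (U \ L).card = U.card := Finset.card_inter_add_card_sdiff U L
    omega
  obtain ⟨φ, hφinj, hφ⟩ := (Finset.all_card_le_biUnion_card_iff_exists_injective t).1 hall
  refine ⟨φ, hφinj, fun S => ?_⟩
  have := hφ S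
  rw [ht, Finset.mem_filter] at this
  exact this.2

/-! ### 2. Transport of the constant-gate weights along the expanding injection -/

/-- One transport step: for `1/2 ≤ g ≤ 1` and `S ⊊ T`, `g · g^{|S|}(1-g)^{k-|S|} ≤ (1-g) · g^{|T|}(1-g)^{k-|T|}`
(the weight grows by `(g/(1-g))^{|T∖S|} ≥ g/(1-g)`). [folklore] -/
theorem transport_step {g : ℝ} (hg : 1 / 2 ≤ g) (hg1 : g ≤ 1) {S T : Finset ι} (hST : S ⊆ T) (hne : S ≠ T) :
    g * (g ^ S.card * (1 - g) ^ (Fintype.card ι - S.card)) ≤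
      (1 - g) * (g ^ T.card * (1 - g) ^ (Fintype.card ι - T.card)) := by
  have hlt : S.card < T.card := Finset.card_lt_card (Finset.ssubset_iff_subset_ne.2 ⟨hST, hne⟩)
  have hTn : T.card ≤ Fintype.card ι := Finset.card_le_univ T
  obtain ⟨d, hd⟩ : ∃ d, T.card = S.card + d + 1 := ⟨T.card - S.card - 1, by omega⟩
  obtain ⟨e, he⟩ : ∃ e, Fintype.card ι - T.card = e := ⟨_, rfl⟩
  have hS : Fintype.card ι - S.card = e + d + 1 := by omega
  rw [hS, he, hd]
  have h0 : 0 ≤ 1 - g := by linarith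
  have hg0 : 0 ≤ g := by linarith
  have hle : (1 - g) ^ d ≤ g ^ d := pow_le_pow_left₀ h0 (by linarith) d
  have hnn : 0 ≤ g ^ (S.card + 1) * (1 - g) ^ (e + 1) := mul_nonneg (pow_nonneg hg0 _) (pow_nonneg h0 _)
  calc g * (g ^ S.card * (1 - g) ^ (e + d + 1))
      = (g ^ (S.card + 1) * (1 - g) ^ (e + 1)) * (1 - g) ^ d := by ring
    _ ≤ (g ^ (S.card + 1) * (1 - g) ^ (e + 1)) * g ^ d := mul_le_mul_of_nonneg_left hle hnn
    _ = (1 - g) * (g ^ (S.card + d + 1) * (1 - g) ^ e) := by ring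

/-- **Transport inequality for the light family** at a constant gate `g ∈ [1/2, 1]` under total mass `≥ 2j+1`:
`g · Σ_{S light} g^{|S|}(1-g)^{k-|S|} ≤ (1-g) · Σ_{T heavy} g^{|T|}(1-g)^{k-|T|}`. [this work] -/
theorem lightFamily_transport (a : ι → ℕ) (j : ℕ) (hT : 2 * j + 1 ≤ ∑ i, a i) {g : ℝ} (hg : 1 / 2 ≤ g)
    (hg1 : g ≤ 1) :
    g * ∑ S ∈ univ.filter (fun S : Finset ι => ∑ i ∈ S, a i ≤ j),
        g ^ S.card * (1 - g) ^ (Fintype.card ι - S.card) ≤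
      (1 - g) * ∑ T ∈ univ.filter (fun T : Finset ι => ¬ ∑ i ∈ T, a i ≤ j),
        g ^ T.card * (1 - g) ^ (Fintype.card ι - T.card) := by
  set L : Finset (Finset ι) := univ.filter fun S : Finset ι => ∑ i ∈ S, a i ≤ j with hL
  set H : Finset (Finset ι) := univ.filter fun T : Finset ι => ¬ ∑ i ∈ T, a i ≤ j with hH
  set wt : Finset ι → ℝ := fun S => g ^ S.card * (1 - g) ^ (Fintype.card ι - S.card) with hwt
  obtain ⟨φ, hφinj, hφ⟩ := exists_expanding_injection a j hT
  have h0 : 0 ≤ 1 - g := by linarith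
  have hg0 : 0 ≤ g := by linarith
  have hwt0 : ∀ S, 0 ≤ wt S := fun S => mul_nonneg (pow_nonneg hg0 _) (pow_nonneg h0 _)
  have hne : ∀ x : L, (x : Finset ι) ≠ φ x := by
    intro x hx
    have h1 : ∑ i ∈ (x : Finset ι), a i ≤ j := (Finset.mem_filter.1 x.2).2
    rw [hx] at h1
    exact (hφ x).2 h1
  have himg : L.attach.image φ ⊆ H := by
    intro T hT'
    rw [Finset.mem_image] at hT'
    obtain ⟨x, -, rfl⟩ := hT'
    rw [hH, Finset.mem_filter]
    exact ⟨Finset.mem_univ _, (hφ x).2⟩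
  rw [Finset.mul_sum, Finset.mul_sum]
  calc ∑ S ∈ L, g * wt S = ∑ x ∈ L.attach, g * wt (x : Finset ι) :=
        (Finset.sum_attach L (fun S => g * wt S)).symm
    _ ≤ ∑ x ∈ L.attach, (1 - g) * wt (φ x) :=
        Finset.sum_le_sum fun x _ => transport_step hg hg1 (hφ x).1 (hne x)
    _ = ∑ T ∈ L.attach.image φ, (1 - g) * wt T := by
        rw [Finset.sum_image fun x _ y _ h => hφinj h]
    _ ≤ ∑ T ∈ H, (1 - g) * wt T :=
        Finset.sum_le_sum_of_subset_of_nonneg himg fun T _ _ => mul_nonneg h0 (hwt0 T)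

/-! ### 3. The constant-gate product measure as a weighted count over the cube -/

/-- At a constant parameter `g` the `prodBernoulli` weight of the configuration `↑S` is `g^{|S|} (1-g)^{k-|S|}`.
[folklore] -/
theorem weight_const_coe (g : ℝ) (S : Finset ι) :
    weight (fun _ : ι => g) (S : Set ι) = g ^ S.card * (1 - g) ^ (Fintype.card ι - S.card) := by
  unfold weight
  simp only [Finset.mem_coe]
  rw [Finset.prod_ite, Finset.prod_const, Finset.prod_const]
  have h1 : (univ.filter fun e : ι => e ∈ S) = S := by
    ext e; simp
  have h2 : (univ.filter fun e : ι => ¬ e ∈ S) = Sᶜ := by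
    ext e; simp
  rw [h1, h2, Finset.card_compl]

/-- `μ_g(C) = Σ_{S : ↑S ∈ C} g^{|S|}(1-g)^{k-|S|}` for the constant-parameter product measure. [folklore] -/
theorem prodBernoulli_const_real_eq_sum (g : unitInterval) (C : Set (Set ι)) :
    (prodBernoulli (fun _ : ι => g)).real C =
      ∑ S ∈ univ.filter (fun S : Finset ι => (S : Set ι) ∈ C),
        (g : ℝ) ^ S.card * (1 - (g : ℝ)) ^ (Fintype.card ι - S.card) := by
  rw [prodBernoulli_real_eq_sum_weight_ind, Finset.sum_filter]
  rw [← Fintype.sum_equiv Fintype.finsetEquivSet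
    (fun S : Finset ι => weight (fun _ : ι => ((g : unitInterval) : ℝ)) (S : Set ι) * ind C (S : Set ι))
    (fun s : Set ι => weight (fun _ : ι => ((g : unitInterval) : ℝ)) s * ind C s) (fun S => rfl)]
  refine Finset.sum_congr rfl fun S _ => ?_
  rw [weight_const_coe]
  by_cases hS : (S : Set ι) ∈ C
  · rw [ind_of_mem hS, mul_one, if_pos hS]
  · rw [ind_of_not_mem hS, mul_zero, if_neg hS]

/-! ### 4. The high-gate theorem (no mean hypothesis) -/

/-- The light event `{s | Σ_{i∈s} a i ≤ j}` of `Set ι` is a down-set. [folklore] -/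
theorem lightEvent_isLowerSet (a : ι → ℕ) (j : ℕ) :
    IsLowerSet {s : Set ι | ∑ i ∈ univ.filter (fun i => i ∈ s), a i ≤ j} := by
  intro s s' hs's hs
  rw [Set.mem_setOf_eq] at hs ⊢
  refine le_trans (Finset.sum_le_sum_of_subset fun i hi => ?_) hs
  rw [Finset.mem_filter] at hi ⊢
  exact ⟨hi.1, hs's hi.2⟩

/-- **Constant gate `g ≥ 1/2`, total mass `≥ 2j+1` ⟹ `μ_g(X ≤ j) ≤ 1 − g`** (the transport bound).
Sharp: `a ≡ 1` on `2j+1` points, `g = 1/2`. [this work] -/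
theorem halfMean_smallBall_const (a : ι → ℕ) (j : ℕ) (hT : 2 * j + 1 ≤ ∑ i, a i) (g : unitInterval)
    (hg : 1 / 2 ≤ (g : ℝ)) :
    (prodBernoulli (fun _ : ι => g)).real {s : Set ι | ∑ i ∈ univ.filter (fun i => i ∈ s), a i ≤ j} ≤
      1 - (g : ℝ) := by
  set E : Set (Set ι) := {s : Set ι | ∑ i ∈ univ.filter (fun i => i ∈ s), a i ≤ j} with hE
  have hg1 : (g : ℝ) ≤ 1 := g.2.2
  -- membership of `↑S` in the light event is lightness of `S`
  have hmem : ∀ S : Finset ι, ((S : Set ι) ∈ E) ↔ (∑ i ∈ S, a i ≤ j) := by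
    intro S
    simp only [hE, Set.mem_setOf_eq, Finset.sum_filter, Finset.mem_coe, Finset.sum_ite_mem,
      Finset.univ_inter]
  have hA : (prodBernoulli (fun _ : ι => g)).real E =
      ∑ S ∈ univ.filter (fun S : Finset ι => ∑ i ∈ S, a i ≤ j),
        (g : ℝ) ^ S.card * (1 - (g : ℝ)) ^ (Fintype.card ι - S.card) := by
    rw [prodBernoulli_const_real_eq_sum]
    simp_rw [hmem]
  have hAc : (prodBernoulli (fun _ : ι => g)).real Eᶜ =
      ∑ S ∈ univ.filter (fun S : Finset ι => ¬ ∑ i ∈ S, a i ≤ j),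
        (g : ℝ) ^ S.card * (1 - (g : ℝ)) ^ (Fintype.card ι - S.card) := by
    rw [prodBernoulli_const_real_eq_sum]
    simp_rw [Set.mem_compl_iff, hmem]
  have hcompl : (prodBernoulli (fun _ : ι => g)).real Eᶜ = 1 - (prodBernoulli (fun _ : ι => g)).real E :=
    probReal_compl_eq_one_sub MeasurableSet.of_discrete
  have htr := lightFamily_transport a j hT hg hg1
  rw [← hA, ← hAc, hcompl] at htr
  nlinarith [htr]

/-- **Half-mean small-ball inequality, high-gate form (no mean hypothesis).**  For independent gates `p_i`
with `1 − p_i ≤ t ≤ 1/2` for every `i` and integer blob sizes with `Σ_i a_i ≥ 2j+1`: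
`P(Σ_{i ∈ s} a_i ≤ j) ≤ t`.  (Monotone coupling down to the constant gate `1 − t`, then
`halfMean_smallBall_const`.) [this work] -/
theorem halfMean_smallBall_of_card (p : ι → unitInterval) (a : ι → ℕ) (j : ℕ) (t : ℝ) (ht2 : t ≤ 1 / 2)
    (ht : ∀ i, 1 - (p i : ℝ) ≤ t) (hT : 2 * j + 1 ≤ ∑ i, a i) :
    (prodBernoulli p).real {s : Set ι | ∑ i ∈ univ.filter (fun i => i ∈ s), a i ≤ j} ≤ t := by
  set E : Set (Set ι) := {s : Set ι | ∑ i ∈ univ.filter (fun i => i ∈ s), a i ≤ j} with hE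
  -- `ι` is nonempty, so `0 ≤ t`
  have hι : Nonempty ι := by
    by_contra h
    rw [not_nonempty_iff] at h
    have : ∑ i, a i = 0 := Finset.sum_eq_zero fun i _ => (IsEmpty.false i).elim
    omega
  obtain ⟨i₀⟩ := hι
  have ht0 : 0 ≤ t := le_trans (by linarith [(p i₀).2.2]) (ht i₀)
  -- the constant gate `g = 1 - t ∈ [1/2, 1]`
  set g : unitInterval := ⟨1 - t, by constructor <;> linarith⟩ with hgdef
  have hgp : (fun _ : ι => g) ≤ p := fun i => by
    show g ≤ p i
    rw [← Subtype.coe_le_coe, hgdef]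
    linarith [ht i]
  have hup : IsUpperSet Eᶜ := (lightEvent_isLowerSet a j).compl
  have hmono : (prodBernoulli (fun _ : ι => g)).real Eᶜ ≤ (prodBernoulli p).real Eᶜ :=
    prodBernoulli_real_mono_of_isUpperSet hgp hup MeasurableSet.of_discrete
  have hc1 : (prodBernoulli (fun _ : ι => g)).real Eᶜ = 1 - (prodBernoulli (fun _ : ι => g)).real E :=
    probReal_compl_eq_one_sub MeasurableSet.of_discrete
  have hc2 : (prodBernoulli p).real Eᶜ = 1 - (prodBernoulli p).real E :=
    probReal_compl_eq_one_sub MeasurableSet.of_discrete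
  have hcore := halfMean_smallBall_const a j hT g (by rw [hgdef]; linarith)
  have hgval : ((g : unitInterval) : ℝ) = 1 - t := rfl
  rw [hgval] at hcore
  linarith

end Quant

end Summit.CriticalPhenomena.PercolationContinuityZ3.Theorems

end
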